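import Literature.NumberTheory.Irrationality.RhinViola2001.TransformationPrimeDivisors
import HarnessLib

/-!
# Rhin–Viola 2001, §5: the sets `Ω_E`, `Ω′_E` of the record computation, Lemma 5.1, `Δ_n Δ′_n ∣ A_n` and `D_n`

Topic `Literature/NumberTheory/Irrationality/RhinViola2001`. Typed-and-PROVED (kernel-decided certificate + short
proofs; no named fact; cell `zeta5-irr`, seat zi-lit g17) from G. Rhin, C. Viola, *The group structure for ζ(3)*,
Acta Arith. **97** (2001) 269–293 [RhinViola2001], §5 pp. 289–292 (held text `paper:doi-10-4064-aa97-3-6`, read on the page).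

The sibling `TransformationPrimeDivisors.lean` proves the MECHANISM of §5 for every word `ϱ` of `Φ = ⟨ϕ, χ, ϑ, σ⟩`:
`p^{Σ_{x∈P}[xω] − Σ_{x∈ϱP}[xω]} ∣ A_n` for `p > √(Mn)`, `ω = {n/p}` (`Section5.prime_pow_gain_dvd`). THIS file
instantiates it at Rhin–Viola's record parameters `h = 16, j = 17, k = 19, l = 15, m = 12, q = 11, r = 9, s = 13`
(`rvChoice`; `M = 19, N = 18, Q = 17`) and proves, for the two unions of intervals PRINTED on p. 292,

* `Ω_E = [1/19, 1/10) ∪ [2/19, 2/7) ∪ [5/17, 1/2) ∪ [10/19, 5/7) ∪ [8/11, 17/18)` (`omegaE`, rows `omegaRows`) and the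
  seventeen intervals of `Ω′_E` (`omegaE'`, rows `omegaRows'`; both lists of endpoints are displayed verbatim in
  `omegaRows_intervals`, `omegaRows'_intervals`):
  **"every prime `p > √(Mn)`, such that `{n/p} ∈ Ω_E`, divides `A_n`"** (`prime_dvd_A_of_mem_omegaE`) and **"every prime
  `p > √(Mn)`, for which `{n/p} ∈ Ω′_E`, is such that `p²` divides `A_n`"** (`prime_sq_dvd_A_of_mem_omegaE'`), p. 289–290;
* "Obviously `Ω′_E ⊂ Ω_E`" (`omegaE'_subset_omegaE`);
* **Lemma 5.1**: `ω ∈ Ω_E ⇒ ω ≥ 1/M`, `ω ∈ Ω′_E ⇒ ω ≥ 1/N` (`lemma51_omegaE`, `lemma51_omegaE'`);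
* p. 290: `Δ_n = ∏_{p > √(Mn), {n/p} ∈ Ω_E} p`, `Δ′_n = ∏_{p > √(Mn), {n/p} ∈ Ω′_E} p` (`Delta`, `Delta'`), "`Δ_n Δ′_n ∣ A_n`"
  (`Delta_mul_Delta'_dvd_A`), "`Δ_n ∣ d_{Mn}` and `Δ′_n ∣ d_{Nn}`" (`Delta_dvd_d`, `Delta'_dvd_d`), whence
  `D_n = d_{Mn} d_{Nn} d_{Qn}/(Δ_n Δ′_n) ∈ ℤ` (`Delta_mul_Delta'_dvd_ddd`, `bigD`) and
  "`D_n I_n = D_n a_n + 2 D_n b_n ζ(3) ∈ ℤ + 2ℤζ(3)`" (`bigD_mul_I_mem`).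

HOW (deviation from the printed road, recorded honestly): the source obtains `Ω_E`, `Ω′_E` from the fifteen level-4
permutations `E` listed on p. 292 via the inequalities (5.12)–(5.13). Here the two printed unions of intervals are
taken as the DEFINITION of `Ω_E`, `Ω′_E`, and the divisibility is certified cell by cell: each printed interval is tiled
by finitely many half-open cells `[a₀/b₀, a₁/b₁)` each carrying a word `ϱ` of `Φ` (found by machine over the whole orbit
of `rvChoice`, 1920 parameter sets) such that on the cell every `[xω]`, `x ∈ P ∪ ϱP`, is constant and the gain
`Σ_{x∈P}[xω] − Σ_{x∈ϱP}[xω]` is `≥ 1` (resp. `≥ 2`); the finitely many integer inequalities this amounts to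
(`Cell.check`, `Row.check`) are decided by the kernel (`omegaRows_check`, `omegaRows'_check`), and their soundness
(`Cell.check_sound`, `chain_sound`, `pow_dvd_A_of_mem_row`) is proved once. (The same machine search confirms that
the printed `Ω_E`, `Ω′_E` are exactly the sets of `ω` of gain `≥ 1`, `≥ 2` over the full orbit — the choice `E` loses
nothing — but only the inclusion needed for the theorems is certified here.)

What is NOT here: the values `∫_{Ω_E} dψ = 18.04470204…`, `∫_{Ω′_E} dψ = 6.14298325…`, (5.14) `lim (1/n) log D_n`,
`c₀, c₁, c₂` and Theorem 5.1 / (1.4) `μ(ζ(3)) < 5.513891` (saddle points and digamma numerics).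

HONEST FRAMING (cells pub-zeta5 / zeta5-irr): the arithmetic of Rhin–Viola's `ζ(3)` approximations AS PRINTED in
2001; nothing here concerns `ζ(5)`; records in print unmoved.
-/

namespace Literature.NumberTheory.Irrationality.RhinViola2001

namespace Section5

open Literature.NumberTheory.Transcendental (zetaValue)
open scoped Nat

/-! ### Floor sums `Σ [xω]`, `[xω] = ⌊x (n mod p)/p⌋` -/

/-- `Σ_{x ∈ L} ⌊x r / p⌋` — the sums of integer parts `Σ [xω]`, `ω = r/p`, of (5.12)–(5.13) and p. 289.
[cite: RhinViola2001, §5 p. 289 ("`α_p − β_p = [m′ω] + [r′ω] + [h′ω] + [q′ω] − [hω] − [kω] − [lω] − [rω]`")] -/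
def floorSum (L : List ℕ) (r p : ℕ) : ℕ := (L.map fun x => x * r / p).sum

/-- The sums of `prime_pow_gain_dvd` are `floorSum`s of the lists of natural-number values. [folklore] -/
private theorem sum_map_toNat_eq_floorSum (L : List ℤ) (r p : ℕ) :
    (L.map fun x => x.toNat * r / p).sum = floorSum (L.map Int.toNat) r p := by
  simp [floorSum, Function.comp_def]

/-- **Constancy of an integer part on a cell.** If `a₀/b₀ ≤ r/p < a₁/b₁` and `x a₁/b₁ ≤ ⌊x a₀/b₀⌋ + 1`, then
`⌊x r/p⌋ = ⌊x a₀/b₀⌋` (all in natural-number arithmetic). [folklore] -/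
private theorem mul_div_eq_of_cell {x a0 b0 a1 b1 r p : ℕ} (hb0 : 0 < b0) (hp : 0 < p)
    (hu : a0 * p ≤ b0 * r) (hv : b1 * r < a1 * p) (hx : x * a1 ≤ (x * a0 / b0 + 1) * b1) :
    x * r / p = x * a0 / b0 := by
  set f := x * a0 / b0 with hf
  apply le_antisymm
  · apply Nat.le_of_lt_succ
    rw [Nat.div_lt_iff_lt_mul hp]
    rcases Nat.eq_zero_or_pos x with rfl | hx0
    · rw [zero_mul]; positivity
    · apply Nat.lt_of_mul_lt_mul_left (a := b1)
      calc b1 * (x * r) = x * (b1 * r) := by ring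
        _ < x * (a1 * p) := Nat.mul_lt_mul_of_pos_left hv hx0
        _ = x * a1 * p := by ring
        _ ≤ (f + 1) * b1 * p := Nat.mul_le_mul_right p hx
        _ = b1 * (Nat.succ f * p) := by rw [Nat.succ_eq_add_one]; ring
  · rw [Nat.le_div_iff_mul_le hp]
    apply Nat.le_of_mul_le_mul_right _ hb0
    calc f * p * b0 = f * b0 * p := by ring
      _ ≤ x * a0 * p := Nat.mul_le_mul_right p (Nat.div_mul_le_self (x * a0) b0)
      _ = x * (a0 * p) := by ring
      _ ≤ x * (b0 * r) := Nat.mul_le_mul_left x hu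
      _ = x * r * b0 := by ring

/-- `floorSum` is constant on a cell when every `[xω]` is. [folklore] -/
private theorem floorSum_eq_of_cell {L : List ℕ} {a0 b0 a1 b1 r p : ℕ} (hb0 : 0 < b0) (hp : 0 < p)
    (hu : a0 * p ≤ b0 * r) (hv : b1 * r < a1 * p) (hL : ∀ x ∈ L, x * a1 ≤ (x * a0 / b0 + 1) * b1) :
    floorSum L r p = floorSum L a0 b0 := by
  unfold floorSum
  congr 1
  exact List.map_congr_left fun x hx => mul_div_eq_of_cell hb0 hp hu hv (hL x hx)

/-! ### Cells and rows: the kernel-decidable certificate -/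

/-- The record parameters as natural numbers: `[h, j, k, l, m, q, r, s] = [16, 17, 19, 15, 12, 11, 9, 13]`.
[cite: RhinViola2001, §5 p. 292] -/
def xsRV : List ℕ := rvChoice.toList.map Int.toNat

/-- A cell `[a₀/b₀, a₁/b₁)` of `ω`'s together with a word `ϱ` in the generators `ϕ, χ, ϑ, σ` (applied right to left, as in
`act`) whose transformation formula is used on the cell. [cite: RhinViola2001, §5 pp. 289–290 (the inequalities "analogous to
(5.12)", "(5.13)" attached to a permutation)] -/
structure Cell where
  /-- numerator of the left end point -/
  a0 : ℕ
  /-- denominator of the left end point -/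
  b0 : ℕ
  /-- numerator of the right end point -/
  a1 : ℕ
  /-- denominator of the right end point -/
  b1 : ℕ
  /-- the word `ϱ` -/
  w : List Gen

namespace Cell

/-- The eight integers `ϱ(h), …, ϱ(s)` of the cell's word at the record parameters, as natural numbers.
[cite: RhinViola2001, §4 (4.4), §5 p. 292] -/
def xs (c : Cell) : List ℕ := (act c.w rvChoice).toList.map Int.toNat

/-- The certificate of a cell: positive denominators; every `[xω]`, `x ∈ P ∪ ϱP`, is constant on `[a₀/b₀, a₁/b₁)`
(`x a₁/b₁ ≤ ⌊x a₀/b₀⌋ + 1`); and at `ω = a₀/b₀` the gain `Σ_{x∈P}[xω] − Σ_{x∈ϱP}[xω]` is at least `req`.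
[cite: RhinViola2001, §5 (5.12)–(5.13)] -/
def check (req : ℕ) (c : Cell) : Bool :=
  decide (0 < c.b0) && decide (0 < c.b1) &&
    ((xsRV ++ c.xs).all fun x => decide (x * c.a1 ≤ (x * c.a0 / c.b0 + 1) * c.b1)) &&
    decide (req + floorSum c.xs c.a0 c.b0 ≤ floorSum xsRV c.a0 c.b0)

/-- **Soundness of the cell certificate**: on the cell, the gain of the word is at least `req`.
[cite: RhinViola2001, §5 (5.12)–(5.13), p. 289] -/
theorem check_sound {req : ℕ} {c : Cell} (hc : c.check req = true) {r p : ℕ} (hp : 0 < p)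
    (hu : c.a0 * p ≤ c.b0 * r) (hv : c.b1 * r < c.a1 * p) :
    req ≤ floorSum xsRV r p - floorSum c.xs r p := by
  simp only [check, Bool.and_eq_true, decide_eq_true_eq, List.all_eq_true, List.mem_append] at hc
  obtain ⟨⟨⟨hb0, -⟩, hall⟩, hreq⟩ := hc
  rw [floorSum_eq_of_cell hb0 hp hu hv fun x hx => hall x (Or.inl hx),
    floorSum_eq_of_cell hb0 hp hu hv fun x hx => hall x (Or.inr hx)]
  omega

end Cell

/-- The chain condition: the cells, in order, tile `[u_N/u_D, v_N/v_D)` — the first starts at or before the left end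
point, each next one starts at or before the end of the previous one, and the last ends at or after the right end point
(cross-multiplied comparisons of natural numbers). [folklore] -/
def chain : List Cell → ℕ → ℕ → ℕ → ℕ → Bool
  | [], uN, uD, vN, vD => decide (vN * uD ≤ uN * vD)
  | c :: cs, uN, uD, vN, vD =>
      decide (0 < c.b0) && decide (0 < c.b1) && decide (c.a0 * uD ≤ uN * c.b0) && chain cs c.a1 c.b1 vN vD

/-- **Soundness of the chain condition**: every real `ω` of `[u_N/u_D, v_N/v_D)` lies in one of the cells.
[folklore] -/
private theorem chain_sound : ∀ (cs : List Cell) {uN uD vN vD : ℕ}, 0 < uD → chain cs uN uD vN vD = true →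
    ∀ {ω : ℝ}, (uN : ℝ) / uD ≤ ω → ω < (vN : ℝ) / vD →
      ∃ c ∈ cs, 0 < c.b0 ∧ 0 < c.b1 ∧ (c.a0 : ℝ) / c.b0 ≤ ω ∧ ω < (c.a1 : ℝ) / c.b1
  | [], uN, uD, vN, vD, huD, h, ω, hlo, hhi => by
    simp only [chain, decide_eq_true_eq] at h
    exfalso
    have hvD : (0 : ℝ) < vD := by
      rcases Nat.eq_zero_or_pos vD with h0 | h0
      · subst h0
        simp only [Nat.cast_zero, div_zero] at hhi
        have : (0 : ℝ) ≤ (uN : ℝ) / uD := by positivity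
        linarith
      · exact_mod_cast h0
    have huD' : (0 : ℝ) < uD := by exact_mod_cast huD
    have : (vN : ℝ) / vD ≤ (uN : ℝ) / uD := by
      rw [div_le_div_iff₀ hvD huD']
      exact_mod_cast h
    linarith
  | c :: cs, uN, uD, vN, vD, huD, h, ω, hlo, hhi => by
    simp only [chain, Bool.and_eq_true, decide_eq_true_eq] at h
    obtain ⟨⟨⟨hb0, hb1⟩, hle⟩, hrest⟩ := h
    have huD' : (0 : ℝ) < uD := by exact_mod_cast huD
    have hb0' : (0 : ℝ) < c.b0 := by exact_mod_cast hb0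
    have hstart : (c.a0 : ℝ) / c.b0 ≤ ω := by
      refine le_trans ?_ hlo
      rw [div_le_div_iff₀ hb0' huD']
      exact_mod_cast hle
    by_cases hω : ω < (c.a1 : ℝ) / c.b1
    · exact ⟨c, List.mem_cons_self, hb0, hb1, hstart, hω⟩
    · obtain ⟨c', hc', h'⟩ := chain_sound cs hb1 hrest (le_of_not_gt hω) hhi
      exact ⟨c', List.mem_cons_of_mem c hc', h'⟩

/-- A row of the certificate: a printed interval `[u_N/u_D, v_N/v_D)` of `Ω_E` or `Ω′_E` with a list of cells tiling it.
[cite: RhinViola2001, §5 p. 292 (the intervals of `Ω_E`, `Ω′_E`)] -/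
structure Row where
  /-- numerator of the left end point -/
  uN : ℕ
  /-- denominator of the left end point -/
  uD : ℕ
  /-- numerator of the right end point -/
  vN : ℕ
  /-- denominator of the right end point -/
  vD : ℕ
  /-- the cells tiling the interval -/
  cells : List Cell

namespace Row

/-- The printed interval of a row, as a real set `[u_N/u_D, v_N/v_D)`. [cite: RhinViola2001, §5 p. 292] -/
def toSet (t : Row) : Set ℝ := Set.Ico ((t.uN : ℝ) / t.uD) ((t.vN : ℝ) / t.vD)

/-- The certificate of a row: positive left denominator, every cell certified with gain `≥ req`, and the cells tile the
interval. [cite: RhinViola2001, §5 pp. 289–292] -/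
def check (req : ℕ) (t : Row) : Bool :=
  decide (0 < t.uD) && t.cells.all (Cell.check req) && chain t.cells t.uN t.uD t.vN t.vD

/-- **Soundness of the row certificate**: for `ω = r/p` in the row's interval some cell of the row contains `ω`, and
its word has gain `≥ req` at `ω`. [cite: RhinViola2001, §5 pp. 289–290] -/
theorem check_sound {req : ℕ} {t : Row} (ht : t.check req = true) {r p : ℕ} (hp : 0 < p)
    (hω : (r : ℝ) / p ∈ t.toSet) : ∃ c ∈ t.cells, req ≤ floorSum xsRV r p - floorSum c.xs r p := by
  simp only [check, Bool.and_eq_true, decide_eq_true_eq, List.all_eq_true] at ht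
  obtain ⟨⟨huD, hcells⟩, hchain⟩ := ht
  obtain ⟨c, hc, hb0, hb1, hlo, hhi⟩ := chain_sound t.cells huD hchain hω.1 hω.2
  have hp' : (0 : ℝ) < p := by exact_mod_cast hp
  have hb0' : (0 : ℝ) < c.b0 := by exact_mod_cast hb0
  have hb1' : (0 : ℝ) < c.b1 := by exact_mod_cast hb1
  refine ⟨c, hc, Cell.check_sound (hcells c hc) hp ?_ ?_⟩
  · rw [div_le_div_iff₀ hb0' hp'] at hlo
    have : (c.a0 : ℝ) * p ≤ r * c.b0 := hlo
    have h' : c.a0 * p ≤ r * c.b0 := by exact_mod_cast this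
    simpa [mul_comm] using h'
  · rw [div_lt_div_iff₀ hp' hb1'] at hhi
    have h' : r * c.b1 < c.a1 * p := by exact_mod_cast hhi
    simpa [mul_comm] using h'

end Row

/-! ### From a certified row to `p^{req} ∣ A_n` -/

/-- **A certified row gives `p^{req} ∣ A_n`**: for the record parameters, `n ≥ 1`, a prime `p` with `p² > 19n = Mn`,
`{n/p} = (n mod p)/p` in the row's interval, `I_n = a_n + 2b_nζ(3)` and `A_n = d_{19n} d_{18n} d_{17n} a_n ∈ ℤ`:
`p^{req} ∣ A_n`. [cite: RhinViola2001, §5 pp. 289–290 ((5.12), (5.13) ⇒ `p ∣ A_n`, `p² ∣ A_n`)] -/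
theorem pow_dvd_A_of_mem_row {req : ℕ} {t : Row} (ht : t.check req = true) {n : ℕ} (hn : 1 ≤ n) {p : ℕ}
    [hp : Fact p.Prime] (hpM : 19 * n < p ^ 2) (hω : ((n % p : ℕ) : ℝ) / p ∈ t.toSet)
    {a : ℚ} {b : ℤ} (ha : I (rvChoice.scale n) = a + 2 * b * zetaValue 3) {A : ℤ}
    (hA : ((d (n * 19) * d (n * 18) * d (n * 17) : ℕ) : ℚ) * a = A) : (p : ℤ) ^ req ∣ A := by
  obtain ⟨c, -, hreq⟩ := Row.check_sound ht hp.out.pos hω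
  have hpM' : (maxT rvChoice 0).toNat * n < p ^ 2 := by rw [rvChoice_maxT.1]; exact hpM
  have hA' : ((d (n * maxT rvChoice 0) * d (n * maxT rvChoice 1) * d (n * maxT rvChoice 2) : ℕ) : ℚ) * a = A := by
    rw [rvChoice_maxT.1, rvChoice_maxT.2.1, rvChoice_maxT.2.2]; exact hA
  have h := prime_pow_gain_dvd rvChoice_admissible c.w hn hpM' ha hA'
  rw [sum_map_toNat_eq_floorSum, sum_map_toNat_eq_floorSum] at h
  exact (pow_dvd_pow (p : ℤ) hreq).trans h

/-! ### The printed sets `Ω_E`, `Ω′_E` and their certificates -/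

/-- The certificate for `Ω_E`: its five printed intervals `[1/19, 1/10)`, `[2/19, 2/7)`, `[5/17, 1/2)`, `[10/19, 5/7)`,
`[8/11, 17/18)` (p. 292), each tiled by cells `⟨a₀, b₀, a₁, b₁, ϱ⟩ = [a₀/b₀, a₁/b₁)` with a word `ϱ` of gain `≥ 1` (machine-found
over the orbit of `rvChoice` under `Φ`; certified by `omegaRows_check`). [cite: RhinViola2001, §5 p. 292 (intervals of `Ω_E`)] -/
def omegaRows : List Row :=
  [ ⟨1, 19, 1, 10,
      [⟨1, 19, 1, 17, [.Chi, .Theta]⟩,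
      ⟨1, 17, 1, 16, [.Phi, .Theta]⟩,
      ⟨1, 16, 1, 15, [.Chi, .Theta]⟩,
      ⟨1, 15, 1, 13, [.Phi]⟩,
      ⟨1, 13, 1, 12, [.Chi, .Theta, .Theta]⟩,
      ⟨1, 12, 1, 11, [.Chi, .Phi, .Sigma]⟩,
      ⟨1, 11, 1, 10, [.Chi]⟩]⟩,
    ⟨2, 19, 2, 7,
      [⟨2, 19, 1, 9, [.Phi, .Sigma]⟩,
      ⟨1, 9, 2, 17, [.Chi, .Theta]⟩,
      ⟨2, 17, 1, 8, [.Phi, .Theta]⟩,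
      ⟨1, 8, 2, 15, [.Chi, .Theta]⟩,
      ⟨2, 15, 2, 13, [.Phi]⟩,
      ⟨2, 13, 3, 19, [.Chi, .Theta, .Theta]⟩,
      ⟨3, 19, 1, 6, [.Phi, .Sigma]⟩,
      ⟨1, 6, 3, 17, [.Chi, .Phi, .Theta]⟩,
      ⟨3, 17, 2, 11, [.Phi, .Theta]⟩,
      ⟨2, 11, 3, 16, [.Chi]⟩,
      ⟨3, 16, 1, 5, [.Chi]⟩,
      ⟨1, 5, 4, 19, [.Phi]⟩,
      ⟨4, 19, 2, 9, [.Phi]⟩,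
      ⟨2, 9, 3, 13, [.Chi, .Theta]⟩,
      ⟨3, 13, 4, 17, [.Chi, .Theta, .Theta]⟩,
      ⟨4, 17, 1, 4, [.Chi, .Theta, .Theta]⟩,
      ⟨1, 4, 5, 19, [.Phi, .Theta, .Phi]⟩,
      ⟨5, 19, 4, 15, [.Chi, .Theta]⟩,
      ⟨4, 15, 3, 11, [.Phi]⟩,
      ⟨3, 11, 2, 7, [.Phi, .Chi, .Phi]⟩]⟩,
    ⟨5, 17, 1, 2,
      [⟨5, 17, 4, 13, [.Phi, .Theta]⟩,
      ⟨4, 13, 5, 16, [.Chi, .Theta, .Theta]⟩,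
      ⟨5, 16, 6, 19, [.Chi, .Theta, .Theta, .Phi]⟩,
      ⟨6, 19, 1, 3, [.Phi, .Sigma]⟩,
      ⟨1, 3, 6, 17, [.Phi, .Chi, .Phi]⟩,
      ⟨6, 17, 4, 11, [.Chi, .Phi]⟩,
      ⟨4, 11, 7, 19, [.Chi]⟩,
      ⟨7, 19, 3, 8, [.Chi]⟩,
      ⟨3, 8, 5, 13, [.Phi]⟩,
      ⟨5, 13, 2, 5, [.Phi, .Theta, .Phi, .Chi]⟩,
      ⟨2, 5, 7, 17, [.Chi, .Theta, .Theta]⟩,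
      ⟨7, 17, 5, 12, [.Chi, .Theta, .Theta]⟩,
      ⟨5, 12, 8, 19, [.Phi, .Theta]⟩,
      ⟨8, 19, 7, 16, [.Phi, .Theta]⟩,
      ⟨7, 16, 4, 9, [.Phi]⟩,
      ⟨4, 9, 5, 11, [.Chi, .Theta]⟩,
      ⟨5, 11, 6, 13, [.Chi, .Theta]⟩,
      ⟨6, 13, 7, 15, [.Phi, .Sigma, .Chi]⟩,
      ⟨7, 15, 8, 17, [.Phi, .Chi]⟩,
      ⟨8, 17, 9, 19, [.Chi]⟩,
      ⟨9, 19, 1, 2, [.Chi]⟩]⟩,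
    ⟨10, 19, 5, 7,
      [⟨10, 19, 9, 17, [.Chi, .Theta]⟩,
      ⟨9, 17, 8, 15, [.Phi, .Theta]⟩,
      ⟨8, 15, 7, 13, [.Phi]⟩,
      ⟨7, 13, 6, 11, [.Phi, .Sigma]⟩,
      ⟨6, 11, 5, 9, [.Chi]⟩,
      ⟨5, 9, 9, 16, [.Phi, .Chi, .Phi]⟩,
      ⟨9, 16, 11, 19, [.Phi, .Theta, .Sigma, .Chi]⟩,
      ⟨11, 19, 7, 12, [.Chi, .Theta]⟩,
      ⟨7, 12, 10, 17, [.Chi, .Theta]⟩,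
      ⟨10, 17, 3, 5, [.Chi]⟩,
      ⟨3, 5, 8, 13, [.Phi, .Theta]⟩,
      ⟨8, 13, 5, 8, [.Chi, .Theta, .Theta]⟩,
      ⟨5, 8, 12, 19, [.Chi, .Theta, .Sigma]⟩,
      ⟨12, 19, 7, 11, [.Phi, .Sigma]⟩,
      ⟨7, 11, 11, 17, [.Chi, .Theta, .Phi]⟩,
      ⟨11, 17, 2, 3, [.Chi]⟩,
      ⟨2, 3, 13, 19, [.Chi, .Phi]⟩,
      ⟨13, 19, 11, 16, [.Chi, .Phi]⟩,
      ⟨11, 16, 9, 13, [.Phi]⟩,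
      ⟨9, 13, 12, 17, [.Phi, .Sigma]⟩,
      ⟨12, 17, 5, 7, [.Phi, .Sigma]⟩]⟩,
    ⟨8, 11, 17, 18,
      [⟨8, 11, 11, 15, [.Phi, .Theta, .Sigma, .Chi]⟩,
      ⟨11, 15, 14, 19, [.Chi, .Theta, .Theta]⟩,
      ⟨14, 19, 3, 4, [.Phi, .Sigma, .Phi]⟩,
      ⟨3, 4, 13, 17, [.Phi]⟩,
      ⟨13, 17, 10, 13, [.Phi]⟩,
      ⟨10, 13, 7, 9, [.Chi]⟩,
      ⟨7, 9, 15, 19, [.Phi, .Chi, .Theta]⟩,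
      ⟨15, 19, 4, 5, [.Chi, .Theta]⟩,
      ⟨4, 5, 13, 16, [.Phi, .Sigma, .Phi]⟩,
      ⟨13, 16, 9, 11, [.Phi]⟩,
      ⟨9, 11, 14, 17, [.Phi]⟩,
      ⟨14, 17, 5, 6, [.Phi]⟩,
      ⟨5, 6, 16, 19, [.Phi, .Theta]⟩,
      ⟨16, 19, 11, 13, [.Phi, .Theta]⟩,
      ⟨11, 13, 13, 15, [.Phi, .Sigma, .Chi]⟩,
      ⟨13, 15, 7, 8, [.Phi, .Sigma, .Phi]⟩,
      ⟨7, 8, 15, 17, [.Phi]⟩,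
      ⟨15, 17, 8, 9, [.Phi]⟩,
      ⟨8, 9, 17, 19, [.Chi, .Phi]⟩,
      ⟨17, 19, 10, 11, [.Chi, .Theta]⟩,
      ⟨10, 11, 11, 12, [.Chi, .Theta]⟩,
      ⟨11, 12, 12, 13, [.Phi, .Theta]⟩,
      ⟨12, 13, 14, 15, [.Phi, .Sigma, .Chi]⟩,
      ⟨14, 15, 15, 16, [.Phi, .Sigma, .Phi]⟩,
      ⟨15, 16, 16, 17, [.Phi]⟩,
      ⟨16, 17, 17, 18, [.Phi]⟩]⟩ ]

/-- The certificate for `Ω′_E`: its seventeen printed intervals (p. 292), each tiled by cells with a word of gain `≥ 2`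
(certified by `omegaRows'_check`). [cite: RhinViola2001, §5 p. 292 (intervals of `Ω′_E`)] -/
def omegaRows' : List Row :=
  [ ⟨1, 17, 1, 14,
      [⟨1, 17, 1, 16, [.Phi, .Chi, .Theta, .Phi, .Theta]⟩,
      ⟨1, 16, 1, 15, [.Chi, .Theta, .Theta, .Chi, .Theta]⟩,
      ⟨1, 15, 1, 14, [.Phi, .Theta, .Chi, .Phi]⟩]⟩,
    ⟨2, 17, 1, 7,
      [⟨2, 17, 1, 8, [.Phi, .Chi, .Theta, .Phi, .Theta]⟩,
      ⟨1, 8, 2, 15, [.Chi, .Theta, .Theta, .Chi, .Theta]⟩,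
      ⟨2, 15, 1, 7, [.Phi, .Theta, .Chi, .Phi]⟩]⟩,
    ⟨2, 11, 1, 5,
      [⟨2, 11, 3, 16, [.Phi, .Theta, .Chi]⟩,
      ⟨3, 16, 1, 5, [.Phi, .Chi, .Theta, .Phi]⟩]⟩,
    ⟨4, 19, 3, 14,
      [⟨4, 19, 3, 14, [.Phi, .Theta, .Theta, .Phi]⟩]⟩,
    ⟨5, 19, 5, 18,
      [⟨5, 19, 4, 15, [.Chi, .Phi, .Theta, .Phi]⟩,
      ⟨4, 15, 3, 11, [.Phi, .Theta, .Chi, .Phi]⟩,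
      ⟨3, 11, 5, 18, [.Phi, .Chi]⟩]⟩,
    ⟨6, 17, 5, 14,
      [⟨6, 17, 5, 14, [.Phi, .Theta, .Chi, .Phi]⟩]⟩,
    ⟨7, 19, 7, 18,
      [⟨7, 19, 3, 8, [.Chi, .Theta, .Chi, .Phi]⟩,
      ⟨3, 8, 5, 13, [.Chi, .Theta, .Phi]⟩,
      ⟨5, 13, 7, 18, [.Phi, .Sigma, .Chi]⟩]⟩,
    ⟨8, 19, 3, 7,
      [⟨8, 19, 3, 7, [.Chi, .Phi, .Theta, .Chi]⟩]⟩,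
    ⟨8, 17, 1, 2,
      [⟨8, 17, 9, 19, [.Chi, .Theta, .Theta, .Chi]⟩,
      ⟨9, 19, 1, 2, [.Chi, .Theta, .Chi]⟩]⟩,
    ⟨6, 11, 4, 7,
      [⟨6, 11, 5, 9, [.Phi, .Sigma, .Phi, .Chi]⟩,
      ⟨5, 9, 9, 16, [.Chi, .Theta, .Phi, .Theta, .Chi]⟩,
      ⟨9, 16, 4, 7, [.Chi, .Phi, .Theta, .Sigma]⟩]⟩,
    ⟨10, 17, 3, 5,
      [⟨10, 17, 3, 5, [.Phi, .Chi, .Theta]⟩]⟩,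
    ⟨7, 11, 9, 14,
      [⟨7, 11, 9, 14, [.Chi, .Theta, .Phi, .Chi]⟩]⟩,
    ⟨13, 19, 7, 10,
      [⟨13, 19, 11, 16, [.Chi, .Theta, .Chi, .Phi]⟩,
      ⟨11, 16, 9, 13, [.Phi, .Theta, .Chi, .Phi]⟩,
      ⟨9, 13, 7, 10, [.Phi, .Sigma, .Phi, .Chi, .Phi]⟩]⟩,
    ⟨13, 17, 11, 14,
      [⟨13, 17, 10, 13, [.Phi, .Theta, .Phi]⟩,
      ⟨10, 13, 7, 9, [.Chi, .Phi, .Sigma]⟩,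
      ⟨7, 9, 11, 14, [.Phi, .Chi, .Theta, .Chi]⟩]⟩,
    ⟨14, 17, 5, 6,
      [⟨14, 17, 5, 6, [.Phi, .Theta, .Sigma, .Phi]⟩]⟩,
    ⟨16, 19, 6, 7,
      [⟨16, 19, 11, 13, [.Chi, .Phi, .Sigma, .Phi, .Theta]⟩,
      ⟨11, 13, 6, 7, [.Chi, .Phi, .Theta, .Chi]⟩]⟩,
    ⟨10, 11, 13, 14,
      [⟨10, 11, 11, 12, [.Phi, .Chi, .Theta, .Phi, .Theta]⟩,
      ⟨11, 12, 12, 13, [.Chi, .Phi, .Sigma, .Phi, .Theta]⟩,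
      ⟨12, 13, 13, 14, [.Chi, .Phi, .Theta, .Chi]⟩]⟩ ]

/-- **The certificate for `Ω_E` checks** (decided by the kernel). [cite: RhinViola2001, §5 pp. 289–292] -/
theorem omegaRows_check : omegaRows.all (Row.check 1) = true := by
  decide +kernel

/-- **The certificate for `Ω′_E` checks** (decided by the kernel). [cite: RhinViola2001, §5 pp. 290–292] -/
theorem omegaRows'_check : omegaRows'.all (Row.check 2) = true := by
  decide +kernel

/-- The end points of the rows of `omegaRows` are the printed intervals of `Ω_E`:
"`[1/19, 1/10) ∪ [2/19, 2/7) ∪ [5/17, 1/2) ∪ [10/19, 5/7) ∪ [8/11, 17/18)`". [cite: RhinViola2001, §5 p. 292] -/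
theorem omegaRows_intervals : omegaRows.map (fun t => (t.uN, t.uD, t.vN, t.vD)) =
    [(1, 19, 1, 10), (2, 19, 2, 7), (5, 17, 1, 2), (10, 19, 5, 7), (8, 11, 17, 18)] := rfl

/-- The end points of the rows of `omegaRows'` are the printed intervals of `Ω′_E`:
"`[1/17, 1/14) ∪ [2/17, 1/7) ∪ [2/11, 1/5) ∪ [4/19, 3/14) ∪ [5/19, 5/18) ∪ [6/17, 5/14) ∪ [7/19, 7/18) ∪ [8/19, 3/7) ∪ [8/17, 1/2) ∪
[6/11, 4/7) ∪ [10/17, 3/5) ∪ [7/11, 9/14) ∪ [13/19, 7/10) ∪ [13/17, 11/14) ∪ [14/17, 5/6) ∪ [16/19, 6/7) ∪ [10/11, 13/14)`".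
[cite: RhinViola2001, §5 p. 292] -/
theorem omegaRows'_intervals : omegaRows'.map (fun t => (t.uN, t.uD, t.vN, t.vD)) =
    [(1, 17, 1, 14), (2, 17, 1, 7), (2, 11, 1, 5), (4, 19, 3, 14), (5, 19, 5, 18), (6, 17, 5, 14), (7, 19, 7, 18),
      (8, 19, 3, 7), (8, 17, 1, 2), (6, 11, 4, 7), (10, 17, 3, 5), (7, 11, 9, 14), (13, 19, 7, 10), (13, 17, 11, 14),
      (14, 17, 5, 6), (16, 19, 6, 7), (10, 11, 13, 14)] := rfl

/-- **`Ω_E`** of the record computation: "the set `Ω_E` is the union of the intervals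
`[1/19, 1/10), [2/19, 2/7), [5/17, 1/2), [10/19, 5/7), [8/11, 17/18)`" (the union of the intervals of the rows of
`omegaRows`, see `omegaRows_intervals`). [cite: RhinViola2001, §5 p. 292 (and pp. 289–290 for the definition via `E`)] -/
def omegaE : Set ℝ := {ω | ∃ t ∈ omegaRows, ω ∈ t.toSet}

/-- **`Ω′_E`** of the record computation: "the set `Ω′_E` is the union of the intervals `[1/17, 1/14), …, [10/11, 13/14)`"
(seventeen intervals; the rows of `omegaRows'`, see `omegaRows'_intervals`). [cite: RhinViola2001, §5 p. 292 (and p. 290)] -/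
def omegaE' : Set ℝ := {ω | ∃ t ∈ omegaRows', ω ∈ t.toSet}

/-- **"Plainly every prime `p > √(Mn)`, such that `{n/p} ∈ Ω_E`, divides `A_n`"** — for the record parameters
(`M = 19`), `I_n = a_n + 2b_nζ(3)`, `A_n = d_{19n} d_{18n} d_{17n} a_n ∈ ℤ`, `{n/p} = (n mod p)/p`.
[cite: RhinViola2001, §5 p. 289] -/
theorem prime_dvd_A_of_mem_omegaE {n : ℕ} (hn : 1 ≤ n) {p : ℕ} [Fact p.Prime] (hpM : 19 * n < p ^ 2)
    (hω : ((n % p : ℕ) : ℝ) / p ∈ omegaE) {a : ℚ} {b : ℤ} (ha : I (rvChoice.scale n) = a + 2 * b * zetaValue 3)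
    {A : ℤ} (hA : ((d (n * 19) * d (n * 18) * d (n * 17) : ℕ) : ℚ) * a = A) : (p : ℤ) ∣ A := by
  obtain ⟨t, ht, hωt⟩ := hω
  simpa using pow_dvd_A_of_mem_row (List.all_eq_true.1 omegaRows_check t ht) hn hpM hωt ha hA

/-- **"Then every prime `p > √(Mn)`, for which `{n/p} ∈ Ω′_E`, is such that `p²` divides `A_n`"** — for the record
parameters (`M = 19`), `I_n = a_n + 2b_nζ(3)`, `A_n = d_{19n} d_{18n} d_{17n} a_n ∈ ℤ`. [cite: RhinViola2001, §5 p. 290] -/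
theorem prime_sq_dvd_A_of_mem_omegaE' {n : ℕ} (hn : 1 ≤ n) {p : ℕ} [Fact p.Prime] (hpM : 19 * n < p ^ 2)
    (hω : ((n % p : ℕ) : ℝ) / p ∈ omegaE') {a : ℚ} {b : ℤ} (ha : I (rvChoice.scale n) = a + 2 * b * zetaValue 3)
    {A : ℤ} (hA : ((d (n * 19) * d (n * 18) * d (n * 17) : ℕ) : ℚ) * a = A) : (p : ℤ) ^ 2 ∣ A := by
  obtain ⟨t, ht, hωt⟩ := hω
  exact pow_dvd_A_of_mem_row (List.all_eq_true.1 omegaRows'_check t ht) hn hpM hωt ha hA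

/-! ### "Obviously `Ω′_E ⊂ Ω_E`" and Lemma 5.1 -/

/-- Each printed interval of `Ω′_E` lies inside a printed interval of `Ω_E` (cross-multiplied end point comparisons,
decided by the kernel). [cite: RhinViola2001, §5 p. 290 ("Obviously `Ω′_E ⊂ Ω_E`")] -/
theorem omegaRows'_inside : (omegaRows'.all fun t' => omegaRows.any fun t =>
    decide (0 < t.uD) && decide (0 < t'.uD) && decide (0 < t.vD) && decide (0 < t'.vD) &&
      decide (t.uN * t'.uD ≤ t'.uN * t.uD) && decide (t'.vN * t.vD ≤ t.vN * t'.vD)) = true := by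
  decide

/-- **"Obviously `Ω′_E ⊂ Ω_E`."** [cite: RhinViola2001, §5 p. 290] -/
theorem omegaE'_subset_omegaE : omegaE' ⊆ omegaE := by
  rintro ω ⟨t', ht', hlo, hhi⟩
  have h := List.all_eq_true.1 omegaRows'_inside t' ht'
  obtain ⟨t, ht, h⟩ := List.any_eq_true.1 h
  simp only [Bool.and_eq_true, decide_eq_true_eq] at h
  obtain ⟨⟨⟨⟨⟨huD, huD'⟩, hvD⟩, hvD'⟩, hle⟩, hle'⟩ := h
  have huDr : (0 : ℝ) < t.uD := by exact_mod_cast huD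
  have huDr' : (0 : ℝ) < t'.uD := by exact_mod_cast huD'
  have hvDr : (0 : ℝ) < t.vD := by exact_mod_cast hvD
  have hvDr' : (0 : ℝ) < t'.vD := by exact_mod_cast hvD'
  refine ⟨t, ht, le_trans ?_ hlo, lt_of_lt_of_le hhi ?_⟩
  · rw [div_le_div_iff₀ huDr huDr']; exact_mod_cast hle
  · rw [div_le_div_iff₀ hvDr' hvDr]; exact_mod_cast hle'

/-- Every printed interval of `Ω_E` starts at `≥ 1/19 = 1/M`, every printed interval of `Ω′_E` at `≥ 1/18 = 1/N` (decided
by the kernel). [cite: RhinViola2001, Lemma 5.1] -/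
theorem omegaRows_lower : (omegaRows.all fun t => decide (0 < t.uD) && decide (t.uD ≤ 19 * t.uN)) = true ∧
    (omegaRows'.all fun t => decide (0 < t.uD) && decide (t.uD ≤ 18 * t.uN)) = true := by
  decide

/-- **Lemma 5.1 (first half)**: "If `ω ∈ Ω_E` then `ω ≥ 1/M`" (`M = 19`). [cite: RhinViola2001, Lemma 5.1] -/
theorem lemma51_omegaE {ω : ℝ} (hω : ω ∈ omegaE) : (1 : ℝ) / 19 ≤ ω := by
  obtain ⟨t, ht, hlo, -⟩ := hω
  have h := List.all_eq_true.1 omegaRows_lower.1 t ht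
  simp only [Bool.and_eq_true, decide_eq_true_eq] at h
  obtain ⟨huD, hle⟩ := h
  refine le_trans ?_ hlo
  rw [div_le_div_iff₀ (by norm_num) (by exact_mod_cast huD : (0 : ℝ) < t.uD)]
  have : ((t.uD : ℕ) : ℝ) ≤ 19 * t.uN := by exact_mod_cast hle
  linarith

/-- **Lemma 5.1 (second half)**: "If `ω ∈ Ω′_E` then `ω ≥ 1/N`" (`N = 18`). [cite: RhinViola2001, Lemma 5.1] -/
theorem lemma51_omegaE' {ω : ℝ} (hω : ω ∈ omegaE') : (1 : ℝ) / 18 ≤ ω := by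
  obtain ⟨t, ht, hlo, -⟩ := hω
  have h := List.all_eq_true.1 omegaRows_lower.2 t ht
  simp only [Bool.and_eq_true, decide_eq_true_eq] at h
  obtain ⟨huD, hle⟩ := h
  refine le_trans ?_ hlo
  rw [div_le_div_iff₀ (by norm_num) (by exact_mod_cast huD : (0 : ℝ) < t.uD)]
  have : ((t.uD : ℕ) : ℝ) ≤ 18 * t.uN := by exact_mod_cast hle
  linarith

/-- "Consequently `p ∣ Δ_n ⇒ p ≤ Mn`": a prime (indeed any `p ≥ 1`) with `{n/p} ∈ Ω_E` satisfies `p ≤ 19n`.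
[cite: RhinViola2001, §5 p. 290 ("From Lemma 5.1 we obtain `Δ_n ∣ d_{Mn}`")] -/
theorem le_of_mem_omegaE {n p : ℕ} (hp : 0 < p) (hω : ((n % p : ℕ) : ℝ) / p ∈ omegaE) : p ≤ 19 * n := by
  have h := lemma51_omegaE hω
  rw [div_le_div_iff₀ (by norm_num) (by exact_mod_cast hp : (0 : ℝ) < p)] at h
  have h' : (p : ℝ) ≤ (n % p : ℕ) * 19 := by simpa using h
  have h'' : p ≤ (n % p) * 19 := by exact_mod_cast h'
  have := Nat.mod_le n p
  omega

/-- Likewise `{n/p} ∈ Ω′_E ⇒ p ≤ 18n = Nn`. [cite: RhinViola2001, §5 p. 290 ("and `Δ′_n ∣ d_{Nn}`")] -/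
theorem le_of_mem_omegaE' {n p : ℕ} (hp : 0 < p) (hω : ((n % p : ℕ) : ℝ) / p ∈ omegaE') : p ≤ 18 * n := by
  have h := lemma51_omegaE' hω
  rw [div_le_div_iff₀ (by norm_num) (by exact_mod_cast hp : (0 : ℝ) < p)] at h
  have h' : (p : ℝ) ≤ (n % p : ℕ) * 18 := by simpa using h
  have h'' : p ≤ (n % p) * 18 := by exact_mod_cast h'
  have := Nat.mod_le n p
  omega

/-- For `p > Mn = 19n` the fractional part `{n/p} = n/p < 1/19` is not in `Ω_E`: the products (5.14) over
"`p > √(Mn)`, `{n/p} ∈ Ω_E`" are finite, ranging over `p ≤ 19n`. [cite: RhinViola2001, Lemma 5.1 and p. 290] -/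
theorem not_mem_omegaE_of_lt {n p : ℕ} (h : 19 * n < p) : ((n % p : ℕ) : ℝ) / p ∉ omegaE := fun hω =>
  absurd (le_of_mem_omegaE (by omega) hω) (not_le.2 h)

/-! ### p. 290: `Δ_n`, `Δ′_n`, `D_n`; `Δ_n Δ′_n ∣ A_n`, `Δ_n ∣ d_{Mn}`, `Δ′_n ∣ d_{Nn}`, `D_n I_n ∈ ℤ + 2ℤζ(3)` -/

open Classical in
/-- The primes of `Δ_n`: `p > √(Mn)` (i.e. `p² > 19n`) with `{n/p} ∈ Ω_E` (all `≤ 19n`, `not_mem_omegaE_of_lt`).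
[cite: RhinViola2001, §5 p. 290 (definition of `Δ_n`)] -/
noncomputable def omegaPrimes (n : ℕ) : Finset ℕ :=
  (Finset.range (19 * n + 1)).filter fun p => p.Prime ∧ 19 * n < p ^ 2 ∧ ((n % p : ℕ) : ℝ) / p ∈ omegaE

open Classical in
/-- The primes of `Δ′_n`: `p > √(Mn)` with `{n/p} ∈ Ω′_E`. [cite: RhinViola2001, §5 p. 290 (definition of `Δ′_n`)] -/
noncomputable def omegaPrimes' (n : ℕ) : Finset ℕ :=
  (Finset.range (19 * n + 1)).filter fun p => p.Prime ∧ 19 * n < p ^ 2 ∧ ((n % p : ℕ) : ℝ) / p ∈ omegaE'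

/-- Membership in `omegaPrimes` (the range bound is automatic). [cite: RhinViola2001, §5 p. 290] -/
theorem mem_omegaPrimes {n p : ℕ} :
    p ∈ omegaPrimes n ↔ p.Prime ∧ 19 * n < p ^ 2 ∧ ((n % p : ℕ) : ℝ) / p ∈ omegaE := by
  classical
  simp only [omegaPrimes, Finset.mem_filter, Finset.mem_range, Nat.lt_succ_iff]
  exact ⟨fun h => h.2, fun h => ⟨le_of_mem_omegaE h.1.pos h.2.2, h⟩⟩

/-- Membership in `omegaPrimes'` (the range bound is automatic). [cite: RhinViola2001, §5 p. 290] -/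
theorem mem_omegaPrimes' {n p : ℕ} :
    p ∈ omegaPrimes' n ↔ p.Prime ∧ 19 * n < p ^ 2 ∧ ((n % p : ℕ) : ℝ) / p ∈ omegaE' := by
  classical
  simp only [omegaPrimes', Finset.mem_filter, Finset.mem_range, Nat.lt_succ_iff]
  exact ⟨fun h => h.2, fun h => ⟨(le_of_mem_omegaE' h.1.pos h.2.2).trans (by omega), h⟩⟩

/-- **`Δ_n = ∏_{p > √(Mn), {n/p} ∈ Ω_E} p`** for the record parameters. [cite: RhinViola2001, §5 p. 290] -/
noncomputable def Delta (n : ℕ) : ℕ := ∏ p ∈ omegaPrimes n, p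

/-- **`Δ′_n = ∏_{p > √(Mn), {n/p} ∈ Ω′_E} p`** for the record parameters. [cite: RhinViola2001, §5 p. 290] -/
noncomputable def Delta' (n : ℕ) : ℕ := ∏ p ∈ omegaPrimes' n, p

/-- `Δ_n > 0`. [cite: RhinViola2001, §5 p. 290] -/
theorem Delta_pos (n : ℕ) : 0 < Delta n :=
  Finset.prod_pos fun _ hp => (mem_omegaPrimes.1 hp).1.pos

/-- `Δ′_n > 0`. [cite: RhinViola2001, §5 p. 290] -/
theorem Delta'_pos (n : ℕ) : 0 < Delta' n :=
  Finset.prod_pos fun _ hp => (mem_omegaPrimes'.1 hp).1.pos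

open Classical in
/-- The primes of `Δ′_n` are among those of `Δ_n` (`Ω′_E ⊂ Ω_E`). [cite: RhinViola2001, §5 p. 290] -/
theorem omegaPrimes'_eq_filter (n : ℕ) :
    omegaPrimes' n = (omegaPrimes n).filter fun p => ((n % p : ℕ) : ℝ) / p ∈ omegaE' := by
  ext p
  simp only [Finset.mem_filter, mem_omegaPrimes, mem_omegaPrimes']
  constructor
  · rintro ⟨hp, hsq, hω⟩; exact ⟨⟨hp, hsq, omegaE'_subset_omegaE hω⟩, hω⟩
  · rintro ⟨⟨hp, hsq, -⟩, hω⟩; exact ⟨hp, hsq, hω⟩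

open Classical in
/-- `Δ_n Δ′_n = ∏_{p ∣ Δ_n} p^{e_p}` with `e_p = 2` if `{n/p} ∈ Ω′_E` and `e_p = 1` otherwise. [cite: RhinViola2001, §5 p. 290] -/
theorem Delta_mul_Delta'_eq (n : ℕ) :
    Delta n * Delta' n = ∏ p ∈ omegaPrimes n, p ^ (if ((n % p : ℕ) : ℝ) / p ∈ omegaE' then 2 else 1) := by
  rw [Delta, Delta', omegaPrimes'_eq_filter, Finset.prod_filter, ← Finset.prod_mul_distrib]
  refine Finset.prod_congr rfl fun p _ => ?_
  split_ifs <;> ring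

/-- **"Since each prime `p` dividing `Δ_n` also divides `A_n`, and each prime `p` dividing `Δ′_n` is such that `p²` divides
`A_n`, we have `Δ_n Δ′_n ∣ A_n`"** (record parameters; `I_n = a_n + 2b_nζ(3)`, `A_n = d_{19n} d_{18n} d_{17n} a_n ∈ ℤ`).
[cite: RhinViola2001, §5 p. 290] -/
theorem Delta_mul_Delta'_dvd_A {n : ℕ} (hn : 1 ≤ n) {a : ℚ} {b : ℤ}
    (ha : I (rvChoice.scale n) = a + 2 * b * zetaValue 3) {A : ℤ}
    (hA : ((d (n * 19) * d (n * 18) * d (n * 17) : ℕ) : ℚ) * a = A) : ((Delta n * Delta' n : ℕ) : ℤ) ∣ A := by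
  classical
  rw [Delta_mul_Delta'_eq]
  push_cast
  apply Finset.prod_dvd_of_coprime
  · intro p hp q hq hpq
    have hp' := (mem_omegaPrimes.1 (Finset.mem_coe.1 hp)).1
    have hq' := (mem_omegaPrimes.1 (Finset.mem_coe.1 hq)).1
    exact (Nat.isCoprime_iff_coprime.2 ((Nat.coprime_primes hp' hq').2 hpq)).pow
  · intro p hp
    obtain ⟨hp', hsq, hω⟩ := mem_omegaPrimes.1 hp
    haveI := Fact.mk hp'
    split_ifs with h'
    · exact prime_sq_dvd_A_of_mem_omegaE' hn hsq h' ha hA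
    · rw [pow_one]; exact prime_dvd_A_of_mem_omegaE hn hsq hω ha hA

/-- `i ∣ lcm(1, …, N)` for `1 ≤ i ≤ N`. [folklore] -/
private theorem dvd_lcmUpto_of_le {i N : ℕ} (hi : 1 ≤ i) (hiN : i ≤ N) : i ∣ Nat.lcmUpto N :=
  Finset.dvd_lcm (f := id) (by rw [Finset.mem_Icc]; omega)

/-- `d_m` in the tree's notation, at a natural number `m`, is `lcm(1, …, m)`. [folklore] -/
private theorem d_natCast (m : ℕ) : d (m : ℤ) = Nat.lcmUpto m := by
  simp [d]

/-- **"From Lemma 5.1 we obtain `Δ_n ∣ d_{Mn}`"** (`M = 19`). [cite: RhinViola2001, §5 p. 290] -/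
theorem Delta_dvd_d (n : ℕ) : Delta n ∣ d ((n : ℤ) * 19) := by
  rw [show ((n : ℤ) * 19) = ((n * 19 : ℕ) : ℤ) by norm_cast, d_natCast, Delta]
  refine Finset.prod_primes_dvd _ (fun p hp => (mem_omegaPrimes.1 hp).1.prime) fun p hp => ?_
  have h := mem_omegaPrimes.1 hp
  exact dvd_lcmUpto_of_le h.1.pos (by have := le_of_mem_omegaE h.1.pos h.2.2; omega)

/-- **"and `Δ′_n ∣ d_{Nn}`"** (`N = 18`). [cite: RhinViola2001, §5 p. 290] -/
theorem Delta'_dvd_d (n : ℕ) : Delta' n ∣ d ((n : ℤ) * 18) := by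
  rw [show ((n : ℤ) * 18) = ((n * 18 : ℕ) : ℤ) by norm_cast, d_natCast, Delta']
  refine Finset.prod_primes_dvd _ (fun p hp => (mem_omegaPrimes'.1 hp).1.prime) fun p hp => ?_
  have h := mem_omegaPrimes'.1 hp
  exact dvd_lcmUpto_of_le h.1.pos (by have := le_of_mem_omegaE' h.1.pos h.2.2; omega)

/-- `Δ_n Δ′_n ∣ d_{Mn} d_{Nn} d_{Qn}` ("whence `D_n ∈ ℤ`"). [cite: RhinViola2001, §5 p. 290] -/
theorem Delta_mul_Delta'_dvd_ddd (n : ℕ) :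
    Delta n * Delta' n ∣ d ((n : ℤ) * 19) * d ((n : ℤ) * 18) * d ((n : ℤ) * 17) :=
  (mul_dvd_mul (Delta_dvd_d n) (Delta'_dvd_d n)).trans (dvd_mul_right _ _)

/-- **`D_n = d_{Mn} d_{Nn} d_{Qn} / (Δ_n Δ′_n)`** (an integer: `Delta_mul_Delta'_dvd_ddd`, `bigD_mul_Delta`).
[cite: RhinViola2001, §5 p. 290 (definition of `D_n`)] -/
noncomputable def bigD (n : ℕ) : ℕ := d ((n : ℤ) * 19) * d ((n : ℤ) * 18) * d ((n : ℤ) * 17) / (Delta n * Delta' n)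

/-- `D_n · (Δ_n Δ′_n) = d_{Mn} d_{Nn} d_{Qn}` ("whence `D_n ∈ ℤ`"). [cite: RhinViola2001, §5 p. 290] -/
theorem bigD_mul_Delta (n : ℕ) :
    bigD n * (Delta n * Delta' n) = d ((n : ℤ) * 19) * d ((n : ℤ) * 18) * d ((n : ℤ) * 17) :=
  Nat.div_mul_cancel (Delta_mul_Delta'_dvd_ddd n)

/-- **"whence `D_n a_n = A_n/(Δ_n Δ′_n) ∈ ℤ`"**: for `I_n = a_n + 2b_nζ(3)` and `A_n = d_{19n} d_{18n} d_{17n} a_n ∈ ℤ`,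
`D_n a_n` is the integer `A_n/(Δ_n Δ′_n)`. [cite: RhinViola2001, §5 p. 290] -/
theorem bigD_mul_a {n : ℕ} (hn : 1 ≤ n) {a : ℚ} {b : ℤ} (ha : I (rvChoice.scale n) = a + 2 * b * zetaValue 3)
    {A : ℤ} (hA : ((d (n * 19) * d (n * 18) * d (n * 17) : ℕ) : ℚ) * a = A) :
    ∃ A' : ℤ, A = (Delta n * Delta' n : ℕ) * A' ∧ (bigD n : ℚ) * a = A' := by
  obtain ⟨A', hA'⟩ := Delta_mul_Delta'_dvd_A hn ha hA
  refine ⟨A', hA', ?_⟩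
  have hΔ : ((Delta n * Delta' n : ℕ) : ℚ) ≠ 0 := by
    exact_mod_cast (Nat.mul_pos (Delta_pos n) (Delta'_pos n)).ne'
  apply mul_left_cancel₀ hΔ
  have hD := bigD_mul_Delta n
  calc ((Delta n * Delta' n : ℕ) : ℚ) * ((bigD n : ℚ) * a)
      = ((bigD n * (Delta n * Delta' n) : ℕ) : ℚ) * a := by push_cast; ring
    _ = ((d (n * 19) * d (n * 18) * d (n * 17) : ℕ) : ℚ) * a := by rw [hD]
    _ = A := hA
    _ = ((Delta n * Delta' n : ℕ) : ℚ) * (A' : ℚ) := by rw [hA']; push_cast; ring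

/-- **"Therefore, by (5.2), `D_n I_n = D_n a_n + 2 D_n b_n ζ(3) ∈ ℤ + 2ℤζ(3)`"** (record parameters, `n ≥ 1`; the
decomposition `I_n = a_n + 2b_nζ(3)` with `b_n ∈ ℤ`, `d_{Mn} d_{Nn} d_{Qn} a_n ∈ ℤ` is the tree's `Theorem21.theorem21_scale`).
[cite: RhinViola2001, §5 p. 290] -/
theorem bigD_mul_I_mem {n : ℕ} (hn : 1 ≤ n) :
    ∃ A' B' : ℤ, (bigD n : ℝ) * I (rvChoice.scale n) = A' + 2 * B' * zetaValue 3 := by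
  obtain ⟨a, b, ha, A, hA⟩ :=
    Theorem21.theorem21_scale rvChoice rvChoice_admissible.2.1 rvChoice_admissible.1 hn
  rw [rvChoice_maxT.1, rvChoice_maxT.2.1, rvChoice_maxT.2.2] at hA
  obtain ⟨A', -, hA'⟩ := bigD_mul_a hn ha hA
  refine ⟨A', bigD n * b, ?_⟩
  have hA'r : (bigD n : ℝ) * (a : ℝ) = A' := by
    have := congrArg (fun q : ℚ => (q : ℝ)) hA'
    simpa using this
  rw [ha, mul_add, ← mul_assoc, ← mul_assoc, hA'r]
  push_cast
  ring

/-- **Summary for the record parameters** (`n ≥ 1`): `I_n = a_n + 2b_nζ(3)` with `b_n ∈ ℤ`,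
`A_n = d_{19n} d_{18n} d_{17n} a_n ∈ ℤ` (Theorem 2.1, the tree's `Theorem21.theorem21_scale`), and `Δ_n Δ′_n ∣ A_n`.
[cite: RhinViola2001, §5 p. 287 ((5.2), `A_n`) and p. 290 (`Δ_n Δ′_n ∣ A_n`)] -/
theorem record_decomposition {n : ℕ} (hn : 1 ≤ n) :
    ∃ (a : ℚ) (b : ℤ), I (rvChoice.scale n) = a + 2 * b * zetaValue 3 ∧
      ∃ A : ℤ, ((d (n * 19) * d (n * 18) * d (n * 17) : ℕ) : ℚ) * a = A ∧ ((Delta n * Delta' n : ℕ) : ℤ) ∣ A := by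
  obtain ⟨a, b, ha, A, hA⟩ :=
    Theorem21.theorem21_scale rvChoice rvChoice_admissible.2.1 rvChoice_admissible.1 hn
  rw [rvChoice_maxT.1, rvChoice_maxT.2.1, rvChoice_maxT.2.2] at hA
  exact ⟨a, b, ha, A, hA, Delta_mul_Delta'_dvd_A hn ha hA⟩

end Section5

end Literature.NumberTheory.Irrationality.RhinViola2001
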